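import Mathlib
import Summits.RiemannHypothesis.RiemannHypothesis.Theorems.WeilFarFloorCoshTest
import Literature.NumberTheory.Sieve.SelbergSymmetryFormula
import Literature.NumberTheory.LFunctions.ChebyshevPsiExplicit
import HarnessLib

/-!
# The cosh quotient `R_c(a) = Q_a(χ_a)/(a + sinh a)` is locally Lipschitz in the window

Helper file (`--supports stmt-RiemannHypothesis-0098`, lead-track anchor: Weil-positivity window ladder, format-C far bound),
pure proofs, RH-free.  Seat rh-explicit-weil-1 gen12 (memo `run/shared/lean/pub/rh-explicit/rh-explicit-weil-1/FORMAT-K3.md` §13.7):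
the last RH-free ingredient of C-XIII″ («under RH, λ_max(a) − R_c(a) → 0»): stage 3 bounds `λ_max(a)` by `R_c(b₁) + η` at a window
`b₁ ∈ (a, a + 2e^{−2a})`, and this file moves `R_c(b₁)` back to `R_c(a)`.

With `χ_a = cosh(·/2)·1_{[−a,a]}` and the closed form `Q_a(χ_a) = Σ_{n ≤ e^{2a}} Λ(n)·φ_n(a)`,
`φ_n(a) = e^a/n − e^{−a} + (2a − log n)(1 + 1/n)/2` (`FloorCosh.primeShiftForm_coshTest`):
* `coshTerm_sub_nonneg`, `coshTerm_sub_le` : each `φ_n` is nondecreasing in `a` with slope `≤ e^{a'}/n + e^{−a} + 2` on `[a, a']`, and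
  `φ_n(log n/2) = 0` (`coshTerm_eq_zero`) — a prime power enters the window continuously;
* `primeShiftForm_coshTest_mono`, `primeShiftForm_coshTest_sub_le` : **`0 ≤ Q_{a'}(χ_{a'}) − Q_a(χ_a) ≤ (a' − a)·25·e^{2a'}`** for
  `0 ≤ a ≤ a'` (Mertens `Σ_{n≤x}Λ/n ≤ log x + 6`, Chebyshev `ψ(x) ≤ (4 + log 4)x`);
* `abs_coshQuotient_sub_le` : **`|Q_{a'}(χ_{a'})/(a' + sinh a') − Q_a(χ_a)/(a + sinh a)| ≤ 200·(a' − a)·e^{2a'}/(a + sinh a)`** for `0 < a ≤ a'`.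
Standard axioms only.
-/

set_option linter.dupNamespace false
set_option autoImplicit false

noncomputable section

open MeasureTheory Set Filter
open scoped Real Topology ArithmeticFunction.vonMangoldt Chebyshev

namespace Summit.RiemannHypothesis.RiemannHypothesis.Theorems.WeilFormatC

namespace FloorCoshSplit

open Literature.NumberTheory.LFunctions

variable {a a' : ℝ}

/-! ## §1 The per-prime-power term -/

/-- `e^{a'} − e^a ≤ (a' − a)e^{a'}` and `e^{a'} − e^a ≥ 0` for `a ≤ a'`. -/
theorem exp_sub_exp_le (h : a ≤ a') : 0 ≤ Real.exp a' - Real.exp a ∧ Real.exp a' - Real.exp a ≤ (a' - a) * Real.exp a' := by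
  refine ⟨sub_nonneg.2 (Real.exp_le_exp.2 h), ?_⟩
  have h1 := Real.add_one_le_exp (a - a')
  have h2 : Real.exp (a - a') * Real.exp a' = Real.exp a := by rw [← Real.exp_add, sub_add_cancel]
  nlinarith [Real.exp_pos a', h1, h2]

/-- `e^{−a} − e^{−a'} ≤ (a' − a)e^{−a}` and `≥ 0` for `a ≤ a'`. -/
theorem exp_neg_sub_exp_neg_le (h : a ≤ a') :
    0 ≤ Real.exp (-a) - Real.exp (-a') ∧ Real.exp (-a) - Real.exp (-a') ≤ (a' - a) * Real.exp (-a) := by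
  refine ⟨sub_nonneg.2 (Real.exp_le_exp.2 (by linarith)), ?_⟩
  have h1 := Real.add_one_le_exp (a - a')
  have h2 : Real.exp (a - a') * Real.exp (-a) = Real.exp (-a') := by rw [← Real.exp_add]; ring_nf
  nlinarith [Real.exp_pos (-a), h1, h2]

/-- **Monotonicity and slope of `φ_n`**: for `n ≥ 1` and `a ≤ a'`,
`0 ≤ φ_n(a') − φ_n(a) ≤ (a' − a)(e^{a'}/n + e^{−a} + 2)`. -/
theorem coshTerm_sub_nonneg_le {n : ℕ} (hn : 1 ≤ n) (h : a ≤ a') :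
    0 ≤ (Real.exp a' / n - Real.exp (-a') + (2 * a' - Real.log n) * (1 + 1 / n) / 2)
        - (Real.exp a / n - Real.exp (-a) + (2 * a - Real.log n) * (1 + 1 / n) / 2) ∧
      (Real.exp a' / n - Real.exp (-a') + (2 * a' - Real.log n) * (1 + 1 / n) / 2)
        - (Real.exp a / n - Real.exp (-a) + (2 * a - Real.log n) * (1 + 1 / n) / 2)
        ≤ (a' - a) * (Real.exp a' / n + Real.exp (-a) + 2) := by
  have hn0 : (0 : ℝ) < n := by exact_mod_cast hn
  have hn1 : (1 : ℝ) ≤ n := by exact_mod_cast hn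
  have hinv : 1 / (n : ℝ) ≤ 1 := by rw [div_le_one hn0]; exact hn1
  have hinv0 : 0 ≤ 1 / (n : ℝ) := by positivity
  obtain ⟨e0, e1⟩ := exp_sub_exp_le h
  obtain ⟨f0, f1⟩ := exp_neg_sub_exp_neg_le h
  have e : (Real.exp a' / n - Real.exp (-a') + (2 * a' - Real.log n) * (1 + 1 / n) / 2)
      - (Real.exp a / n - Real.exp (-a) + (2 * a - Real.log n) * (1 + 1 / n) / 2)
      = (Real.exp a' - Real.exp a) * (1 / n) + (Real.exp (-a) - Real.exp (-a')) + (a' - a) * (1 + 1 / n) := by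
    field_simp; ring
  rw [e]
  constructor
  · have : 0 ≤ (a' - a) * (1 + 1 / (n : ℝ)) := mul_nonneg (by linarith) (by linarith)
    nlinarith [mul_nonneg e0 hinv0]
  · have h3 : (Real.exp a' - Real.exp a) * (1 / n) ≤ (a' - a) * Real.exp a' * (1 / n) :=
      mul_le_mul_of_nonneg_right e1 hinv0
    have h4 : (a' - a) * (1 + 1 / (n : ℝ)) ≤ (a' - a) * 2 := mul_le_mul_of_nonneg_left (by linarith) (by linarith)
    have e' : (a' - a) * (Real.exp a' / n + Real.exp (-a) + 2)
        = (a' - a) * Real.exp a' * (1 / n) + (a' - a) * Real.exp (-a) + (a' - a) * 2 := by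
      field_simp
    rw [e']; linarith

/-- **A prime power enters continuously**: `φ_n(log n/2) = 0` (`n ≥ 1`). -/
theorem coshTerm_eq_zero {n : ℕ} (hn : 1 ≤ n) :
    Real.exp (Real.log n / 2) / n - Real.exp (-(Real.log n / 2)) + (2 * (Real.log n / 2) - Real.log n) * (1 + 1 / n) / 2 = 0 := by
  have hn0 : (0 : ℝ) < n := by exact_mod_cast hn
  rw [Real.exp_neg]
  set s := Real.exp (Real.log n / 2) with hs
  have hs0 : 0 < s := Real.exp_pos _
  have hss : s * s = n := by rw [hs, ← Real.exp_add, add_halves, Real.exp_log hn0]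
  have h1 : s / (n : ℝ) = s⁻¹ := by
    rw [div_eq_iff hn0.ne', ← hss, inv_mul_cancel_left₀ hs0.ne']
  rw [h1]; ring

/-! ## §2 The closed form is monotone and Lipschitz in the window -/

/-- **`0 ≤ Q_{a'}(χ_{a'}) − Q_a(χ_a) ≤ (a' − a)·25·e^{2a'}`** for `0 ≤ a ≤ a'`. -/
theorem primeShiftForm_coshTest_sub_nonneg_le (ha : 0 ≤ a) (h : a ≤ a') :
    0 ≤ primeShiftForm a' ((Icc (-a') a').indicator (fun y ↦ Real.cosh (y / 2)))
        - primeShiftForm a ((Icc (-a) a).indicator (fun y ↦ Real.cosh (y / 2))) ∧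
      primeShiftForm a' ((Icc (-a') a').indicator (fun y ↦ Real.cosh (y / 2)))
        - primeShiftForm a ((Icc (-a) a).indicator (fun y ↦ Real.cosh (y / 2)))
        ≤ (a' - a) * (25 * Real.exp (2 * a')) := by
  rw [FloorCosh.primeShiftForm_coshTest a, FloorCosh.primeShiftForm_coshTest a']
  obtain ⟨φ, hφ⟩ : ∃ φ : ℕ → ℝ → ℝ, ∀ (n : ℕ) (c : ℝ),
      φ n c = Real.exp c / n - Real.exp (-c) + (2 * c - Real.log n) * (1 + 1 / n) / 2 := ⟨_, fun _ _ ↦ rfl⟩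
  simp only [← hφ]
  set N := ⌊Real.exp (2 * a)⌋₊ with hN
  set N' := ⌊Real.exp (2 * a')⌋₊ with hN'
  have hNN : N ≤ N' := Nat.floor_le_floor (Real.exp_le_exp.2 (by linarith))
  have hsplit := Finset.sum_Ioc_consecutive (fun n ↦ (Λ n : ℝ) * φ n a') (Nat.zero_le N) hNN
  -- termwise bounds
  have hold : ∀ n ∈ Finset.Ioc 0 N, 0 ≤ (Λ n : ℝ) * φ n a' - (Λ n : ℝ) * φ n a ∧
      (Λ n : ℝ) * φ n a' - (Λ n : ℝ) * φ n a ≤ (a' - a) * ((Λ n : ℝ) * (Real.exp a' / n + Real.exp (-a) + 2)) := by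
    intro n hn
    rw [Finset.mem_Ioc] at hn
    obtain ⟨h0, h1⟩ := coshTerm_sub_nonneg_le (a := a) (a' := a') hn.1 h
    rw [← hφ, ← hφ] at h0 h1
    have hΛ : 0 ≤ (Λ n : ℝ) := ArithmeticFunction.vonMangoldt_nonneg
    refine ⟨by rw [← mul_sub]; exact mul_nonneg hΛ h0, ?_⟩
    rw [← mul_sub]
    nlinarith [mul_le_mul_of_nonneg_left h1 hΛ]
  have hnew : ∀ n ∈ Finset.Ioc N N', 0 ≤ (Λ n : ℝ) * φ n a' ∧
      (Λ n : ℝ) * φ n a' ≤ (a' - a) * ((Λ n : ℝ) * (Real.exp a' / n + Real.exp (-a) + 2)) := by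
    intro n hn
    rw [Finset.mem_Ioc] at hn
    have hn1 : 1 ≤ n := by omega
    have hn0 : (0 : ℝ) < n := by exact_mod_cast hn1
    have hΛ : 0 ≤ (Λ n : ℝ) := ArithmeticFunction.vonMangoldt_nonneg
    -- `a ≤ log n / 2 ≤ a'`
    have hlo : a ≤ Real.log n / 2 := by
      have : Real.exp (2 * a) < n := (Nat.floor_lt (Real.exp_pos _).le).1 hn.1
      have := (Real.lt_log_iff_exp_lt hn0).2 this
      linarith
    have hhi : Real.log n / 2 ≤ a' := by
      have : (n : ℝ) ≤ Real.exp (2 * a') := (Nat.le_floor_iff (Real.exp_pos _).le).1 hn.2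
      have := (Real.log_le_iff_le_exp hn0).2 this
      linarith
    obtain ⟨h0, h1⟩ := coshTerm_sub_nonneg_le (a := Real.log n / 2) (a' := a') hn1 hhi
    rw [coshTerm_eq_zero hn1, sub_zero, ← hφ] at h0 h1
    refine ⟨mul_nonneg hΛ h0, ?_⟩
    have hexp : Real.exp (-(Real.log n / 2)) ≤ Real.exp (-a) := Real.exp_le_exp.2 (by linarith)
    have h2 : φ n a' ≤ (a' - a) * (Real.exp a' / n + Real.exp (-a) + 2) := by
      refine h1.trans ?_
      have hpos : 0 ≤ Real.exp a' / n + Real.exp (-(Real.log n / 2)) + 2 := by positivity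
      calc (a' - Real.log n / 2) * (Real.exp a' / n + Real.exp (-(Real.log n / 2)) + 2)
          ≤ (a' - a) * (Real.exp a' / n + Real.exp (-(Real.log n / 2)) + 2) :=
            mul_le_mul_of_nonneg_right (by linarith) hpos
        _ ≤ (a' - a) * (Real.exp a' / n + Real.exp (-a) + 2) :=
            mul_le_mul_of_nonneg_left (by linarith) (by linarith)
    exact mul_le_mul_of_nonneg_left h2 hΛ |>.trans (le_of_eq (by ring))
  -- the weight sums: Mertens and Chebyshev
  have hx1 : (1 : ℝ) ≤ Real.exp (2 * a') := Real.one_le_exp (by linarith)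
  have hM : ∑ n ∈ Finset.Ioc 0 N', (Λ n : ℝ) / n ≤ 2 * a' + 6 := by
    have h := Literature.NumberTheory.Sieve.SelbergSymmetry.abs_sum_vonMangoldt_div_sub_log_le hx1
    rw [Real.log_exp] at h
    have := (abs_le.1 h).2
    rw [hN']; linarith
  have hC : ∑ n ∈ Finset.Ioc 0 N', (Λ n : ℝ) ≤ 6 * Real.exp (2 * a') := by
    have h1 : ∑ n ∈ Finset.Ioc 0 N', (Λ n : ℝ) = ψ (N' : ℝ) := (ChebyshevExplicit.psi_natCast N').symm
    have h2 := Chebyshev.psi_le_const_mul_self (Nat.cast_nonneg N' : (0 : ℝ) ≤ N')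
    have h3 : (N' : ℝ) ≤ Real.exp (2 * a') := Nat.floor_le (Real.exp_pos _).le
    have h4 : Real.log 4 + 4 ≤ 6 := by
      have : Real.log 4 = 2 * Real.log 2 := by
        rw [show (4 : ℝ) = 2 ^ 2 by norm_num, Real.log_pow]; norm_num
      rw [this]; linarith [Real.log_two_lt_d9]
    rw [h1]
    calc ψ (N' : ℝ) ≤ (Real.log 4 + 4) * N' := h2
      _ ≤ 6 * Real.exp (2 * a') := mul_le_mul h4 h3 (Nat.cast_nonneg _) (by norm_num)
  have hW : ∑ n ∈ Finset.Ioc 0 N', (Λ n : ℝ) * (Real.exp a' / n + Real.exp (-a) + 2) ≤ 25 * Real.exp (2 * a') := by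
    have e : ∑ n ∈ Finset.Ioc 0 N', (Λ n : ℝ) * (Real.exp a' / n + Real.exp (-a) + 2)
        = Real.exp a' * ∑ n ∈ Finset.Ioc 0 N', (Λ n : ℝ) / n
          + (Real.exp (-a) + 2) * ∑ n ∈ Finset.Ioc 0 N', (Λ n : ℝ) := by
      rw [Finset.mul_sum, Finset.mul_sum, ← Finset.sum_add_distrib]
      exact Finset.sum_congr rfl fun n _ ↦ by ring
    rw [e]
    have hea : Real.exp (-a) ≤ 1 := by rw [Real.exp_le_one_iff]; linarith
    have he1 : Real.exp a' ≤ Real.exp (2 * a') := Real.exp_le_exp.2 (by linarith)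
    have he2 : Real.exp a' * (2 * a' + 6) ≤ Real.exp (2 * a') * 7 := by
      -- `2a' + 6 ≤ 7e^{a'}` from `e^{a'} ≥ 1 + a'`
      have := Real.add_one_le_exp a'
      have h7 : 2 * a' + 6 ≤ 7 * Real.exp a' := by linarith
      calc Real.exp a' * (2 * a' + 6) ≤ Real.exp a' * (7 * Real.exp a') :=
            mul_le_mul_of_nonneg_left h7 (Real.exp_pos _).le
        _ = Real.exp (2 * a') * 7 := by rw [show 2 * a' = a' + a' by ring, Real.exp_add]; ring
    have hs0 : 0 ≤ ∑ n ∈ Finset.Ioc 0 N', (Λ n : ℝ) := Finset.sum_nonneg fun n _ ↦ ArithmeticFunction.vonMangoldt_nonneg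
    nlinarith [mul_le_mul_of_nonneg_left hM (Real.exp_pos a').le, mul_le_mul hea hC hs0 zero_le_one,
      mul_le_mul_of_nonneg_left hC (show (0 : ℝ) ≤ 2 by norm_num), Real.exp_pos (2 * a')]
  -- assemble
  rw [← hsplit]
  have hdiff : (∑ n ∈ Finset.Ioc 0 N, (Λ n : ℝ) * φ n a' + ∑ n ∈ Finset.Ioc N N', (Λ n : ℝ) * φ n a')
      - ∑ n ∈ Finset.Ioc 0 N, (Λ n : ℝ) * φ n a
      = ∑ n ∈ Finset.Ioc 0 N, ((Λ n : ℝ) * φ n a' - (Λ n : ℝ) * φ n a) + ∑ n ∈ Finset.Ioc N N', (Λ n : ℝ) * φ n a' := by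
    rw [Finset.sum_sub_distrib]; ring
  have hsum2 := Finset.sum_Ioc_consecutive (fun n ↦ (Λ n : ℝ) * (Real.exp a' / n + Real.exp (-a) + 2)) (Nat.zero_le N) hNN
  refine ⟨?_, ?_⟩
  · rw [hdiff]
    exact add_nonneg (Finset.sum_nonneg fun n hn ↦ (hold n hn).1) (Finset.sum_nonneg fun n hn ↦ (hnew n hn).1)
  · rw [hdiff]
    calc ∑ n ∈ Finset.Ioc 0 N, ((Λ n : ℝ) * φ n a' - (Λ n : ℝ) * φ n a) + ∑ n ∈ Finset.Ioc N N', (Λ n : ℝ) * φ n a'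
        ≤ ∑ n ∈ Finset.Ioc 0 N, (a' - a) * ((Λ n : ℝ) * (Real.exp a' / n + Real.exp (-a) + 2))
          + ∑ n ∈ Finset.Ioc N N', (a' - a) * ((Λ n : ℝ) * (Real.exp a' / n + Real.exp (-a) + 2)) :=
          add_le_add (Finset.sum_le_sum fun n hn ↦ (hold n hn).2) (Finset.sum_le_sum fun n hn ↦ (hnew n hn).2)
      _ = (a' - a) * ∑ n ∈ Finset.Ioc 0 N', (Λ n : ℝ) * (Real.exp a' / n + Real.exp (-a) + 2) := by
          rw [← Finset.mul_sum, ← Finset.mul_sum, ← mul_add, hsum2]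
      _ ≤ (a' - a) * (25 * Real.exp (2 * a')) := mul_le_mul_of_nonneg_left hW (by linarith)

/-! ## §3 The quotient -/

/-- **The cosh quotient is locally Lipschitz in the window**: for `0 < a ≤ a'`,
`|Q_{a'}(χ_{a'})/(a' + sinh a') − Q_a(χ_a)/(a + sinh a)| ≤ 200·(a' − a)·e^{2a'}/(a + sinh a)`. -/
theorem abs_coshQuotient_sub_le (ha : 0 < a) (h : a ≤ a') :
    |primeShiftForm a' ((Icc (-a') a').indicator (fun y ↦ Real.cosh (y / 2))) / (a' + Real.sinh a')
        - primeShiftForm a ((Icc (-a) a).indicator (fun y ↦ Real.cosh (y / 2))) / (a + Real.sinh a)|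
      ≤ 200 * (a' - a) * Real.exp (2 * a') / (a + Real.sinh a) := by
  have ha' : 0 < a' := ha.trans_le h
  -- sizes (gathered before abbreviating): `0 ≤ F`, `0 ≤ F' − F ≤ 25(a'−a)e^{2a'}`, `F' ≤ 38(e^{a'}+1)P'`
  obtain ⟨hF0', -⟩ := primeShiftForm_coshTest_sub_nonneg_le (a := 0) (a' := a) le_rfl ha.le
  have hz : primeShiftForm 0 ((Icc (-(0 : ℝ)) 0).indicator (fun y ↦ Real.cosh (y / 2))) = 0 := by
    rw [FloorCosh.primeShiftForm_coshTest]; simp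
  rw [hz, sub_zero] at hF0'
  obtain ⟨hd0, hd1⟩ := primeShiftForm_coshTest_sub_nonneg_le ha.le h
  have hFb : primeShiftForm a' ((Icc (-a') a').indicator (fun y ↦ Real.cosh (y / 2)))
      ≤ 38 * (Real.exp a' + 1) * (a' + Real.sinh a') := by
    obtain ⟨hCm, hCb, hCs⟩ := FloorCosh.coshTest_admissible a'
    have h1 := primeShiftForm_le_floor_mul hCm hCb hCs
    rw [FloorCosh.integral_coshTest_sq ha'.le] at h1
    have hP'0 : 0 < a' + Real.sinh a' := by have := Real.sinh_pos_iff.2 ha'; linarith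
    exact h1.trans (mul_le_mul_of_nonneg_right (farCoercivityFloor_le_trivial ha') hP'0.le)
  set F := primeShiftForm a ((Icc (-a) a).indicator (fun y ↦ Real.cosh (y / 2))) with hF
  set F' := primeShiftForm a' ((Icc (-a') a').indicator (fun y ↦ Real.cosh (y / 2))) with hF'
  set P := a + Real.sinh a with hP
  set P' := a' + Real.sinh a' with hP'
  have hP0 : 0 < P := by have := Real.sinh_pos_iff.2 ha; rw [hP]; linarith
  have hPP : P ≤ P' := by rw [hP, hP']; exact add_le_add h (Real.sinh_le_sinh.2 h)
  have hP'0 : 0 < P' := hP0.trans_le hPP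
  have hF'0 : 0 ≤ F' := by linarith
  have hPd : P' - P ≤ (a' - a) * (1 + Real.exp a') := by
    obtain ⟨-, e1⟩ := exp_sub_exp_le h
    obtain ⟨-, f1⟩ := exp_neg_sub_exp_neg_le h
    rw [hP, hP', Real.sinh_eq, Real.sinh_eq]
    have : Real.exp (-a) ≤ Real.exp a' := Real.exp_le_exp.2 (by linarith)
    nlinarith [mul_le_mul_of_nonneg_left this (sub_nonneg.2 h)]
  -- the two one-sided bounds
  have hup : F' / P' - F / P ≤ (a' - a) * (25 * Real.exp (2 * a')) / P := by
    have h1 : F' / P' - F / P ≤ (F' - F) / P := by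
      rw [div_sub_div _ _ hP'0.ne' hP0.ne', div_le_div_iff₀ (mul_pos hP'0 hP0) hP0]
      have key : F' * P * P ≤ F' * P' * P := mul_le_mul_of_nonneg_right (mul_le_mul_of_nonneg_left hPP hF'0) hP0.le
      linarith [key]
    exact h1.trans (div_le_div_of_nonneg_right hd1 hP0.le)
  have hdown : F / P - F' / P' ≤ 38 * (Real.exp a' + 1) * ((a' - a) * (1 + Real.exp a')) / P := by
    have h1 : F / P - F' / P' ≤ F' * (P' - P) / (P * P') := by
      rw [div_sub_div _ _ hP0.ne' hP'0.ne', div_le_div_iff₀ (mul_pos hP0 hP'0) (mul_pos hP0 hP'0)]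
      have hFF : F ≤ F' := by linarith
      have key : F * P' * (P * P') ≤ F' * P' * (P * P') :=
        mul_le_mul_of_nonneg_right (mul_le_mul_of_nonneg_right hFF hP'0.le) (mul_pos hP0 hP'0).le
      linarith [key]
    refine h1.trans ?_
    rw [div_le_div_iff₀ (mul_pos hP0 hP'0) hP0]
    have h2 : F' * (P' - P) ≤ 38 * (Real.exp a' + 1) * P' * ((a' - a) * (1 + Real.exp a')) :=
      mul_le_mul hFb hPd (by linarith) (by positivity)
    nlinarith [h2, hP0, hP'0]
  -- crude unification of the constants: both numerators are `≤ 200 (a'−a) e^{2a'}`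
  have he : Real.exp a' + 1 ≤ 2 * Real.exp a' := by linarith [Real.one_le_exp ha'.le]
  have he2 : Real.exp a' * Real.exp a' = Real.exp (2 * a') := by rw [← Real.exp_add]; ring_nf
  have haa : 0 ≤ a' - a := sub_nonneg.2 h
  rw [abs_le]
  constructor
  · have : 38 * (Real.exp a' + 1) * ((a' - a) * (1 + Real.exp a')) ≤ 200 * (a' - a) * Real.exp (2 * a') := by
      have h3 : (Real.exp a' + 1) * (1 + Real.exp a') ≤ 4 * Real.exp (2 * a') := by nlinarith [Real.exp_pos a']
      nlinarith [mul_le_mul_of_nonneg_left h3 haa]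
    have := hdown.trans (div_le_div_of_nonneg_right this hP0.le)
    linarith
  · refine hup.trans (div_le_div_of_nonneg_right ?_ hP0.le)
    nlinarith [Real.exp_pos (2 * a')]

end FloorCoshSplit

end Summit.RiemannHypothesis.RiemannHypothesis.Theorems.WeilFormatC
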